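import Literature.NumberTheory.EllipticCurves.PAdicDistributionIntegral
import HarnessLib

/-!
# Bounded distributions on profinite towers: SHIFTING the levels and RESTRICTING to a fiber-closed
# family of cells — the measure `μ|_{ℤ_p^×}` of de Shalit 1987, I.3.3 ("`μ̃ = μ|ℤ_p^×`, extended by `0`")

De Shalit 1987, I.3.3 (p. 17–18): "The measure `μ_β` is actually supported on `ℤ_p^×`. […] Indeed, if
`μ̃ = μ|ℤ_p^×`, extended by `0` to `pℤ_p`, then `P_μ̃ = P̃_μ` […] We may now use the isomorphism (9)
`κ : G ≃ ℤ_p^×` […] to pull back `μ_β` to `G`."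

Two small operations on the tree's `BoundedDistribution T 𝕜` (`PAdicDistributionIntegral.lean`) needed
to feed a measure on `ℤ_p` (e.g. the inverse Amice transform `invAmice₁` of a Coleman power series,
`PAdicOneVariableInverseTransform.lean`) into the Galois-side pull-back `GroupDistribution.comap`
(`ProfiniteGroupDistributionComap.lean`), whose cell maps `κ mod p^{n+1} : Gal(K̄/F)/Gal(K̄/F_{n+1}) ≃
(ℤ/p^{n+1})^×` see the UNIT classes of the levels `n + 1`:

* §1 `ProfiniteTower.succ` (`Cell n := T.Cell (n+1)`) and `BoundedDistribution.succ` (drop level `0`);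
  `integral_succ` (same integrals);
* §2 `BoundedDistribution.restrict S hS` for a FIBER-CLOSED family of cells `S n ⊆ T.Cell n`
  (`b ∈ S (n+1) ↔ trans b ∈ S n`): zero outside `S`, unchanged inside — again a distribution;
  `integral_restrict : ∫ f d(μ|_S) = ∫ 𝟙_S f dμ` (`𝟙_S` read at level `0`);
* §3 the `p`-adic case: in the shifted tower `(padicInt p).succ` (cells `ℤ/p^{n+1}`) the unit classes
  are fiber-closed (`isUnit_trans_iff`), whence **`restrictUnits ν`** = `μ|_{ℤ_p^×}` with
  `restrictUnits_μ` and `integral_restrictUnits : ∫ f d(μ|_{ℤ_p^×}) = ∫ 𝟙_{ℤ_p^×} f dμ`.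

Everything is a definition with a body or a theorem; no named facts, no instances, no `sorry`.

## References

* [deShalit1987] E. de Shalit, *Iwasawa theory of elliptic curves with complex multiplication* (1987),
  I.3.3 (7′)–(9) (p. 17–18).
* [MazurTateTeitelbaum1986Invent] B. Mazur, J. Tate, J. Teitelbaum, Invent. Math. 84 (1986), §I.11.
-/

noncomputable section

open Filter Topology
open scoped Classical

namespace Literature.NumberTheory.EllipticCurves

/-! ### §1. Shifting the levels by one -/

namespace ProfiniteTower

variable {X : Type*} [PseudoMetricSpace X] (T : ProfiniteTower X)

/-- **The shifted tower**: level `n` of `T.succ` is level `n + 1` of `T` (cells, projections,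
transition maps, representatives). [cite: MazurTateTeitelbaum1986Invent, §I.11] -/
def succ : ProfiniteTower X where
  Cell n := T.Cell (n + 1)
  instFintype n := T.instFintype (n + 1)
  instDecidableEq n := T.instDecidableEq (n + 1)
  proj n := T.proj (n + 1)
  trans n := T.trans (n + 1)
  repr n := T.repr (n + 1)
  proj_repr n a := T.proj_repr (n + 1) a
  trans_proj n x := T.trans_proj (n + 1) x
  exists_forall_dist_lt ε hε := by
    obtain ⟨N, hN⟩ := T.exists_forall_dist_lt ε hε
    exact ⟨N, fun n hn x y h ↦ hN (n + 1) (by omega) x y h⟩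

/-- The cells of the shifted tower. [cite: MazurTateTeitelbaum1986Invent, §I.11] -/
@[simp] theorem succ_Cell (n : ℕ) : T.succ.Cell n = T.Cell (n + 1) := rfl

/-- The projections of the shifted tower. [cite: MazurTateTeitelbaum1986Invent, §I.11] -/
@[simp] theorem succ_proj (n : ℕ) (x : X) : T.succ.proj n x = T.proj (n + 1) x := rfl

/-- The transition maps of the shifted tower. [cite: MazurTateTeitelbaum1986Invent, §I.11] -/
@[simp] theorem succ_trans (n : ℕ) (b : T.Cell (n + 1 + 1)) : T.succ.trans n b = T.trans (n + 1) b := rfl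

/-- The representatives of the shifted tower. [cite: MazurTateTeitelbaum1986Invent, §I.11] -/
@[simp] theorem succ_repr (n : ℕ) (a : T.Cell (n + 1)) : T.succ.repr n a = T.repr (n + 1) a := rfl

end ProfiniteTower

namespace BoundedDistribution

variable {X : Type*} [PseudoMetricSpace X] {T : ProfiniteTower X}
variable {𝕜 : Type*} [NormedField 𝕜] (D : BoundedDistribution T 𝕜)

/-- **The shifted distribution** on the shifted tower (forget level `0`).
[cite: MazurTateTeitelbaum1986Invent, §I.11] -/
def succ : BoundedDistribution T.succ 𝕜 where
  μ n a := D.μ (n + 1) a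
  sum_fiber n a := D.sum_fiber (n + 1) a
  bound := D.bound
  bound_nonneg := D.bound_nonneg
  norm_le n a := D.norm_le (n + 1) a

/-- The level data of the shifted distribution. [cite: MazurTateTeitelbaum1986Invent, §I.11] -/
@[simp] theorem succ_μ (n : ℕ) (a : T.Cell (n + 1)) : D.succ.μ n a = D.μ (n + 1) a := rfl

/-- The bound of the shifted distribution. [cite: MazurTateTeitelbaum1986Invent, §I.11] -/
@[simp] theorem succ_bound : D.succ.bound = D.bound := rfl

/-- The Riemann sums of the shifted distribution are those of `D`, one level up.
[cite: MazurTateTeitelbaum1986Invent, §I.11] -/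
theorem riemannSum_succ (f : X → 𝕜) (n : ℕ) : D.succ.riemannSum f n = D.riemannSum f (n + 1) := rfl

/-- **Shifting does not change integrals** (of uniformly continuous functions, `𝕜` complete
non-archimedean): the Riemann sums are a subsequence. [cite: MazurTateTeitelbaum1986Invent, §I.11] -/
theorem integral_succ [IsUltrametricDist 𝕜] [CompleteSpace 𝕜] {f : X → 𝕜} (hf : UniformContinuous f) :
    D.succ.integral f = D.integral f := by
  have h1 : Tendsto (D.succ.riemannSum f) atTop (𝓝 (D.integral f)) := by
    have h := (D.tendsto_riemannSum_integral hf).comp (tendsto_add_atTop_nat 1)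
    exact h
  exact tendsto_nhds_unique (D.succ.tendsto_riemannSum_integral hf) h1

/-! ### §2. Restriction to a fiber-closed family of cells -/

/-- **Restriction of a distribution to a fiber-closed family of cells** `S n ⊆ T.Cell n`
(`b ∈ S (n+1) ↔ trans b ∈ S n`, i.e. `S` is the clopen set `proj_0⁻¹(S 0)` read at every level):
zero outside `S`, unchanged inside — "`μ|_S`, extended by `0`". [cite: deShalit1987, I.3.3 (p. 17–18)] -/
def restrict (S : (n : ℕ) → Set (T.Cell n)) (hS : ∀ (n : ℕ) (b : T.Cell (n + 1)), b ∈ S (n + 1) ↔ T.trans n b ∈ S n) :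
    BoundedDistribution T 𝕜 where
  μ n a := if a ∈ S n then D.μ n a else 0
  sum_fiber n a := by
    by_cases ha : a ∈ S n
    · rw [if_pos ha, ← D.sum_fiber n a]
      refine Finset.sum_congr rfl fun b hb ↦ ?_
      rw [if_pos ((hS n b).mpr (by rw [(Finset.mem_filter.mp hb).2]; exact ha))]
    · rw [if_neg ha]
      refine Finset.sum_eq_zero fun b hb ↦ ?_
      rw [if_neg (fun h ↦ ha (by rw [← (Finset.mem_filter.mp hb).2]; exact (hS n b).mp h))]
  bound := D.bound
  bound_nonneg := D.bound_nonneg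
  norm_le n a := by
    split_ifs
    · exact D.norm_le n a
    · rw [norm_zero]; exact D.bound_nonneg

/-- The level data of the restriction. [cite: deShalit1987, I.3.3 (p. 17–18)] -/
theorem restrict_μ (S : (n : ℕ) → Set (T.Cell n)) (hS) (n : ℕ) (a : T.Cell n) :
    (D.restrict S hS).μ n a = if a ∈ S n then D.μ n a else 0 := rfl

/-- The bound of the restriction is that of `D`. [cite: deShalit1987, I.3.3 (p. 17–18)] -/
@[simp] theorem restrict_bound (S : (n : ℕ) → Set (T.Cell n)) (hS) : (D.restrict S hS).bound = D.bound :=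
  rfl

omit [PseudoMetricSpace X] in
/-- For a fiber-closed family, membership of the cell of a point is decided at level `0`.
[cite: deShalit1987, I.3.3 (p. 17–18)] -/
theorem _root_.Literature.NumberTheory.EllipticCurves.ProfiniteTower.proj_mem_iff_proj_zero_mem
    {X : Type*} [PseudoMetricSpace X] (T : ProfiniteTower X) (S : (n : ℕ) → Set (T.Cell n))
    (hS : ∀ (n : ℕ) (b : T.Cell (n + 1)), b ∈ S (n + 1) ↔ T.trans n b ∈ S n) (x : X) (n : ℕ) :
    T.proj n x ∈ S n ↔ T.proj 0 x ∈ S 0 := by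
  induction n with
  | zero => exact Iff.rfl
  | succ n ih => rw [hS n, T.trans_proj, ih]

/-- **The Riemann sums of the restriction** are those of `𝟙_S · f` against `D`.
[cite: deShalit1987, I.3.3 (p. 17–18)] -/
theorem riemannSum_restrict (S : (n : ℕ) → Set (T.Cell n)) (hS) (f : X → 𝕜) (n : ℕ) :
    (D.restrict S hS).riemannSum f n =
      D.riemannSum (fun x ↦ (if T.proj 0 x ∈ S 0 then (1 : 𝕜) else 0) * f x) n := by
  rw [riemannSum_def, riemannSum_def]
  refine Finset.sum_congr rfl fun a _ ↦ ?_
  have hmem : T.proj 0 (T.repr n a) ∈ S 0 ↔ a ∈ S n := by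
    rw [← T.proj_mem_iff_proj_zero_mem S hS (T.repr n a) n, T.proj_repr]
  rw [restrict_μ]
  by_cases ha : a ∈ S n
  · rw [if_pos ha, if_pos (hmem.mpr ha), one_mul]
  · rw [if_neg ha, if_neg (fun h ↦ ha (hmem.mp h)), zero_mul, mul_zero]

/-- **`∫ f d(μ|_S) = ∫ 𝟙_S · f dμ`** (no continuity needed: the Riemann sums agree termwise).
[cite: deShalit1987, I.3.3 (p. 17–18)] -/
theorem integral_restrict (S : (n : ℕ) → Set (T.Cell n)) (hS) (f : X → 𝕜) :
    (D.restrict S hS).integral f = D.integral (fun x ↦ (if T.proj 0 x ∈ S 0 then (1 : 𝕜) else 0) * f x) := by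
  have h : (D.restrict S hS).riemannSum f =
      D.riemannSum (fun x ↦ (if T.proj 0 x ∈ S 0 then (1 : 𝕜) else 0) * f x) :=
    funext fun n ↦ D.riemannSum_restrict S hS f n
  rw [integral, integral, h]

end BoundedDistribution

/-! ### §3. The `p`-adic case: `μ|_{ℤ_p^×}` on the shifted tower `ℤ_p = lim ℤ/p^{n+1}` -/

section PadicUnits

variable {p : ℕ} [Fact p.Prime] {𝕜 : Type*} [NormedField 𝕜]

/-- In `ℤ/p^{d}`, `d ≥ 1`, an element is a unit iff `p` does not divide its canonical representative.
[cite: deShalit1987, I.3.3 (p. 17–18)] -/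
theorem ZMod_isUnit_iff_not_dvd_val {d : ℕ} (hd : 0 < d) (b : ZMod (p ^ d)) : IsUnit b ↔ ¬ p ∣ b.val := by
  haveI : NeZero (p ^ d) := ⟨pow_ne_zero _ (Fact.out : p.Prime).ne_zero⟩
  conv_lhs => rw [← ZMod.natCast_zmod_val b]
  exact ZMod.isUnit_natCast_iff_not_dvd_pow (Fact.out : p.Prime) hd

/-- **The unit classes are fiber-closed in the shifted `p`-adic tower**: a class modulo `p^{n+2}` is a
unit iff its reduction modulo `p^{n+1}` is. [cite: deShalit1987, I.3.3 (p. 17–18)] -/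
theorem isUnit_trans_iff (n : ℕ) (b : ZMod (p ^ (n + 1 + 1))) :
    IsUnit (M := ZMod (p ^ (n + 1))) ((ProfiniteTower.padicInt p).succ.trans n b) ↔ IsUnit b := by
  haveI : NeZero (p ^ (n + 1 + 1)) := ⟨pow_ne_zero _ (Fact.out : p.Prime).ne_zero⟩
  haveI : NeZero (p ^ (n + 1)) := ⟨pow_ne_zero _ (Fact.out : p.Prime).ne_zero⟩
  rw [ProfiniteTower.succ_trans, ProfiniteTower.padicInt_trans, ZMod_isUnit_iff_not_dvd_val (by omega) b]
  have hcast : ZMod.castHom (pow_dvd_pow p (n + 1).le_succ) (ZMod (p ^ (n + 1))) b =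
      ((b.val : ℕ) : ZMod (p ^ (n + 1))) := by
    conv_lhs => rw [← ZMod.natCast_zmod_val b]
    rw [map_natCast]
  rw [hcast, ZMod.isUnit_natCast_iff_not_dvd_pow (Fact.out : p.Prime) (by omega)]

variable (p) in
/-- The unit classes of the shifted `p`-adic tower (level `n` = classes modulo `p^{n+1}`).
[cite: deShalit1987, I.3.3 (p. 17–18)] -/
def unitCells : (n : ℕ) → Set ((ProfiniteTower.padicInt p).succ.Cell n) :=
  fun n ↦ {b | IsUnit (M := ZMod (p ^ (n + 1))) b}

/-- Membership in `unitCells`. [cite: deShalit1987, I.3.3 (p. 17–18)] -/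
theorem mem_unitCells (n : ℕ) (b : ZMod (p ^ (n + 1))) :
    (b : (ProfiniteTower.padicInt p).succ.Cell n) ∈ unitCells p n ↔ IsUnit b := Iff.rfl

/-- The unit classes are fiber-closed. [cite: deShalit1987, I.3.3 (p. 17–18)] -/
theorem unitCells_fiberClosed (n : ℕ) (b : (ProfiniteTower.padicInt p).succ.Cell (n + 1)) :
    b ∈ unitCells p (n + 1) ↔ (ProfiniteTower.padicInt p).succ.trans n b ∈ unitCells p n :=
  (isUnit_trans_iff n b).symm

/-- **`μ|_{ℤ_p^×}`**: the restriction of (the shift of) a bounded distribution `ν` on `ℤ_p` to the unit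
classes — de Shalit's "`μ̃ = μ|ℤ_p^×`, extended by `0` to `pℤ_p`", on the tower of the classes modulo
`p^{n+1}` (where the units are visible from level `0` on). [cite: deShalit1987, I.3.3 (7′) (p. 17–18)] -/
def restrictUnits (ν : BoundedDistribution (ProfiniteTower.padicInt p) 𝕜) :
    BoundedDistribution (ProfiniteTower.padicInt p).succ 𝕜 :=
  ν.succ.restrict (unitCells p) unitCells_fiberClosed

/-- The level data of `μ|_{ℤ_p^×}`: `ν(b + p^{n+1}ℤ_p)` on unit classes `b`, `0` otherwise.
[cite: deShalit1987, I.3.3 (7′) (p. 17–18)] -/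
theorem restrictUnits_μ (ν : BoundedDistribution (ProfiniteTower.padicInt p) 𝕜) (n : ℕ)
    (b : ZMod (p ^ (n + 1))) :
    (restrictUnits ν).μ n b = if IsUnit b then ν.μ (n + 1) b else 0 := by
  change (if b ∈ unitCells p n then ν.μ (n + 1) b else 0) = _
  split_ifs with h1 h2 h2
  · rfl
  · exact (h2 h1).elim
  · exact (h1 h2).elim
  · rfl

/-- `μ|_{ℤ_p^×}` vanishes on the non-unit classes (the support hypothesis of
`GroupDistribution.integral_comap`). [cite: deShalit1987, I.3.3 (7′) (p. 17–18)] -/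
theorem isUnit_of_restrictUnits_μ_ne_zero (ν : BoundedDistribution (ProfiniteTower.padicInt p) 𝕜) (n : ℕ)
    (b : ZMod (p ^ (n + 1))) (h : (restrictUnits ν).μ n b ≠ 0) : IsUnit b := by
  by_contra hb
  rw [restrictUnits_μ, if_neg hb] at h
  exact h rfl

/-- The bound of `μ|_{ℤ_p^×}` is that of `ν`. [cite: deShalit1987, I.3.3 (7′) (p. 17–18)] -/
@[simp] theorem restrictUnits_bound (ν : BoundedDistribution (ProfiniteTower.padicInt p) 𝕜) :
    (restrictUnits ν).bound = ν.bound := rfl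

/-- **`∫ f d(μ|_{ℤ_p^×}) = ∫ 𝟙_{ℤ_p^×} f dμ`** (`𝟙_{ℤ_p^×}(x)` read as "`x mod p` is a unit"; `f` uniformly
continuous, `𝕜` complete non-archimedean). [cite: deShalit1987, I.3.3 (7′) (p. 17–18)] -/
theorem integral_restrictUnits [IsUltrametricDist 𝕜] [CompleteSpace 𝕜]
    (ν : BoundedDistribution (ProfiniteTower.padicInt p) 𝕜) {f : ℤ_[p] → 𝕜}
    (hf : UniformContinuous (fun x ↦ (if IsUnit (PadicInt.toZModPow 1 x) then (1 : 𝕜) else 0) * f x)) :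
    (restrictUnits ν).integral f =
      ν.integral (fun x ↦ (if IsUnit (PadicInt.toZModPow 1 x) then (1 : 𝕜) else 0) * f x) := by
  have hfun : (fun x : ℤ_[p] ↦ (if (ProfiniteTower.padicInt p).succ.proj 0 x ∈ unitCells p 0 then (1 : 𝕜)
      else 0) * f x) = fun x ↦ (if IsUnit (PadicInt.toZModPow 1 x) then (1 : 𝕜) else 0) * f x := by
    funext x
    split_ifs with h1 h2 h2
    · rfl
    · exact (h2 h1).elim
    · exact (h1 h2).elim
    · rfl
  rw [restrictUnits, ν.succ.integral_restrict, hfun, ν.integral_succ hf]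

end PadicUnits

end Literature.NumberTheory.EllipticCurves

end
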